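import Mathlib
import Literature.AlgebraicGeometry.Resolution.CobordantGame
import Literature.AlgebraicGeometry.Resolution.PointBlowupFlagInvariant
import Summits.ResolutionOfSingularities.ResolutionOfSingularities.Theorems.WeightedInvariantLocalWeightedDropInsepPointStep

/-!
# `WeightedInvariant.LocalWeightedDrop`, line `hasse-ridge-face-selection`: CLEANING a purely inseparable char-`2` double
# point — `y² + A₀` versus `y² + cleanSeries 2 A₀` (the position is `A₀` modulo squares)

Crux item stmt-ResolutionOfSingularities-8899 `LocalWeightedDrop` (route `ResolutionOfSingularities/WeightedInvariant`),
serving the door `WeightedConstruction` stmt-ResolutionOfSingularities-0571.  [OURS · L1 W4.3, chain w43, stub worker 3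
(gen 2): support for unit (u1) «POSITION = A₀ mod squares» of CRUX-PLAN v2 §v2.3 (piece S2iM
`stub_charTwoInseparableReductionWon`); bridges the game to the Literature operation `HauserPerlega2024.cleanSeries`
(removal of the `q`-th power monomials, [cite: HauserPerlega2024, §5 p. 783]); NOT a statement of any manuscript.]

* `InsepCleaning.coeff_sq_eq_zero_of_not_even`, `coeff_two_nsmul_sq`: in characteristic `2` the square of a power series
  `φ` has `[x^{2e}] φ² = ([x^e] φ)²` and no other monomials (the swap involution on the antidiagonal);
* `InsepCleaning.exists_cleanSeries_two_eq_add_sq`: over an algebraically closed field of characteristic `2`, for every `A`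
  there is `φ` with `φ(0)² = A(0)` and `cleanSeries 2 A = A + φ²` (`φ` = the square root of the even part);
* `InsepCleaning.order_le_order_cleanSeries`: cleaning does not lower the order;
* `won_dp_cleanSeries_iff`: for `A₀(0) = 0`, `y² + cleanSeries 2 A₀` is won iff `y² + A₀` is won
  (`InsepDoublePoint.won_dp_add_sq_iff`) — the class INSEP is a game on `k[[x₀,x₁]]` modulo squares.
-/

set_option linter.dupNamespace false -- mandated namespace of this single-conjunct summit

namespace Summit.ResolutionOfSingularities.ResolutionOfSingularities.Theorems

open Literature.AlgebraicGeometry.Resolution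
open Literature.AlgebraicGeometry.Resolution.CobordantGame

namespace InsepCleaning

open MvPowerSeries

variable {k : Type} [Field k] {σ : Type}

/-! ### Squares of power series in characteristic `2` -/

/-- An exponent all of whose entries are even is twice an exponent. -/
theorem exists_eq_two_nsmul_of_even {d : σ →₀ ℕ} (h : ∀ i, 2 ∣ d i) : ∃ e : σ →₀ ℕ, d = 2 • e := by
  refine ⟨d.mapRange (· / 2) (by simp), ?_⟩
  ext i
  simp only [Finsupp.smul_apply, Finsupp.mapRange_apply, smul_eq_mul]
  obtain ⟨m, hm⟩ := h i
  omega

/-- A symmetric pair on the antidiagonal of `d` forces `d` to be even. -/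
theorem even_of_add_self_eq {d e : σ →₀ ℕ} (h : e + e = d) (i : σ) : 2 ∣ d i :=
  ⟨e i, by rw [← h, Finsupp.add_apply]; ring⟩

/-- In characteristic `2`, `φ²` has NO monomial with an odd exponent. -/
theorem coeff_sq_eq_zero_of_not_even [CharP k 2] (φ : MvPowerSeries σ k) {d : σ →₀ ℕ} (hd : ¬ ∀ i, 2 ∣ d i) :
    coeff d (φ ^ 2) = 0 := by
  classical
  rw [sq, coeff_mul]
  refine Finset.sum_involution (fun a _ => a.swap) (fun a _ => ?_) (fun a ha _ => ?_) (fun a ha => ?_) (fun a _ => ?_)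
  · rw [Prod.fst_swap, Prod.snd_swap, mul_comm (coeff a.2 φ), CharTwo.add_self_eq_zero]
  · intro h
    rw [Finset.HasAntidiagonal.mem_antidiagonal] at ha
    have h1 : a.1 = a.2 := congrArg Prod.snd h
    rw [← h1] at ha
    exact hd (even_of_add_self_eq ha)
  · rw [Finset.HasAntidiagonal.mem_antidiagonal] at ha ⊢
    rw [Prod.fst_swap, Prod.snd_swap, add_comm, ha]
  · exact Prod.swap_swap a

/-- In characteristic `2`, `[x^{2e}] φ² = ([x^e] φ)²`. -/
theorem coeff_two_nsmul_sq [CharP k 2] (φ : MvPowerSeries σ k) (e : σ →₀ ℕ) :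
    coeff (2 • e) (φ ^ 2) = coeff e φ ^ 2 := by
  classical
  have hee : (e, e) ∈ Finset.HasAntidiagonal.antidiagonal (2 • e) := by
    rw [Finset.HasAntidiagonal.mem_antidiagonal, two_nsmul]
  rw [sq, coeff_mul, ← Finset.add_sum_erase _ _ hee, sq]
  suffices h0 : ∑ x ∈ (Finset.HasAntidiagonal.antidiagonal (2 • e)).erase (e, e), coeff x.1 φ * coeff x.2 φ = 0 by
    rw [h0, add_zero]
  refine Finset.sum_involution (fun a _ => a.swap) (fun a _ => ?_) (fun a ha _ => ?_) (fun a ha => ?_) (fun a _ => ?_)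
  · rw [Prod.fst_swap, Prod.snd_swap, mul_comm (coeff a.2 φ), CharTwo.add_self_eq_zero]
  · intro h
    rw [Finset.mem_erase, Finset.HasAntidiagonal.mem_antidiagonal] at ha
    have h1 : a.1 = a.2 := congrArg Prod.snd h
    apply ha.1
    have hae : a.1 = e := by
      ext i
      have h2 := congrArg (fun f => f i) ha.2
      simp only [Finsupp.add_apply, Finsupp.smul_apply, smul_eq_mul, ← h1] at h2
      omega
    exact Prod.ext hae (h1 ▸ hae)
  · rw [Finset.mem_erase, Finset.HasAntidiagonal.mem_antidiagonal] at ha ⊢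
    refine ⟨fun h => ha.1 ?_, by rw [Prod.fst_swap, Prod.snd_swap, add_comm, ha.2]⟩
    rw [← Prod.swap_swap a, h]
    rfl
  · exact Prod.swap_swap a

/-! ### The square root of the even part, and `cleanSeries 2` -/

/-- Over an algebraically closed field every power series has a «square root of its even part»: `([x^e] φ)² = [x^{2e}] A`. -/
theorem exists_sq_coeff_eq [IsAlgClosed k] (A : MvPowerSeries σ k) :
    ∃ φ : MvPowerSeries σ k, ∀ e : σ →₀ ℕ, coeff e φ ^ 2 = coeff (2 • e) A := by
  have h : ∀ e : σ →₀ ℕ, ∃ z : k, z ^ 2 = coeff (2 • e) A := fun e =>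
    IsAlgClosed.exists_pow_nat_eq _ two_pos
  choose z hz using h
  exact ⟨fun e => z e, fun e => hz e⟩

/-- The coefficients of `cleanSeries q`. -/
theorem coeff_cleanSeries (q : ℕ) (H : MvPowerSeries σ k) (d : σ →₀ ℕ) [Decidable (∀ i, q ∣ d i)] :
    coeff d (HauserPerlega2024.cleanSeries q H) = if ∀ i, q ∣ d i then 0 else coeff d H := by
  rw [coeff_apply, coeff_apply, HauserPerlega2024.cleanSeries]
  split_ifs <;> rfl

/-- CLEANING IS RE-CENTRING BY A SQUARE (characteristic `2`, `k` algebraically closed): `cleanSeries 2 A = A + φ²` with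
`φ(0)² = A(0)`. -/
theorem exists_cleanSeries_two_eq_add_sq [CharP k 2] [IsAlgClosed k] (A : MvPowerSeries σ k) :
    ∃ φ : MvPowerSeries σ k, constantCoeff φ ^ 2 = constantCoeff A ∧
      HauserPerlega2024.cleanSeries 2 A = A + φ ^ 2 := by
  classical
  obtain ⟨φ, hφ⟩ := exists_sq_coeff_eq A
  refine ⟨φ, ?_, ?_⟩
  · have h := hφ 0
    rwa [smul_zero, coeff_zero_eq_constantCoeff_apply, coeff_zero_eq_constantCoeff_apply] at h
  · ext d
    rw [coeff_cleanSeries, map_add]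
    split_ifs with hd
    · obtain ⟨e, rfl⟩ := exists_eq_two_nsmul_of_even hd
      rw [coeff_two_nsmul_sq, hφ e, CharTwo.add_self_eq_zero]
    · rw [coeff_sq_eq_zero_of_not_even φ hd, add_zero]

/-- Cleaning does not lower the order. -/
theorem order_le_order_cleanSeries (q : ℕ) (A : MvPowerSeries σ k) :
    A.order ≤ (HauserPerlega2024.cleanSeries q A).order := by
  classical
  refine le_order fun d hd => ?_
  rw [coeff_cleanSeries]
  split_ifs
  · rfl
  · exact coeff_of_lt_order hd

/-- A cleaned series has no even monomials; in particular no constant term. -/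
theorem constantCoeff_cleanSeries (q : ℕ) (A : MvPowerSeries σ k) :
    constantCoeff (HauserPerlega2024.cleanSeries q A) = 0 := by
  classical
  rw [← coeff_zero_eq_constantCoeff_apply, coeff_cleanSeries, if_pos fun i => by simp]

/-- Cleaning is idempotent. -/
theorem cleanSeries_cleanSeries (q : ℕ) (A : MvPowerSeries σ k) :
    HauserPerlega2024.cleanSeries q (HauserPerlega2024.cleanSeries q A) = HauserPerlega2024.cleanSeries q A := by
  classical
  ext d
  rw [coeff_cleanSeries, coeff_cleanSeries]
  split_ifs <;> rfl

end InsepCleaning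

open InsepCleaning InsepDoublePoint MvPowerSeries in
/-- THE CLASS INSEP IS A GAME MODULO SQUARES (characteristic `2`, `k` algebraically closed): for `A₀(0) = 0`, the germ
`y² + cleanSeries 2 A₀` is won iff `y² + A₀` is won — `cleanSeries 2 A₀ = A₀ + φ²` with `φ(0) = 0`, and re-centring `y ↦ y + φ`
is a legal move (`InsepDoublePoint.won_dp_add_sq_iff`). [OURS · L1 W4.3, support for (u1) of CRUX-PLAN v2] -/
theorem won_dp_cleanSeries_iff (k : Type) [Field k] [CharP k 2] [IsAlgClosed k] (A₀ : MvPowerSeries (Fin 2) k)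
    (h0 : MvPowerSeries.constantCoeff A₀ = 0) :
    CobordantGame.Won k 3 (MvPowerSeries.X (Fin.last 2) ^ 2 +
        MvPowerSeries.rename (Fin.succAboveEmb (Fin.last 2)) (HauserPerlega2024.cleanSeries 2 A₀)) ↔
      CobordantGame.Won k 3 (MvPowerSeries.X (Fin.last 2) ^ 2 +
        MvPowerSeries.rename (Fin.succAboveEmb (Fin.last 2)) A₀) := by
  obtain ⟨φ, hφ0, heq⟩ := exists_cleanSeries_two_eq_add_sq A₀
  rw [h0] at hφ0
  rw [heq]
  exact won_dp_add_sq_iff φ (pow_eq_zero_iff two_ne_zero |>.mp hφ0) A₀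

open InsepCleaning InsepDoublePoint MvPowerSeries in
/-- A position and its cleaning: `ord (cleanSeries 2 A₀) > 2` whenever `ord A₀ > 2`, so the cleaned series is again a
position of the class INSEP. -/
theorem two_lt_order_cleanSeries {k : Type} [Field k] (A₀ : MvPowerSeries (Fin 2) k) (hA₀ : (2 : ℕ∞) < A₀.order) :
    (2 : ℕ∞) < (HauserPerlega2024.cleanSeries 2 A₀).order :=
  lt_of_lt_of_le hA₀ (order_le_order_cleanSeries 2 A₀)

end Summit.ResolutionOfSingularities.ResolutionOfSingularities.Theorems
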